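import Summits.AtomisticToContinuum.FouriersLaw.Theorems.BondHeatUncertaintySubdiffusiveBondHeatTransientSpectral
import Summits.AtomisticToContinuum.FouriersLaw.Theorems.BondHeatUncertaintySubdiffusiveBondHeatSpectralNonneg
import Summits.AtomisticToContinuum.FouriersLaw.Theorems.BondHeatUncertaintySubdiffusiveBondHeatTransientFormula
import Summits.AtomisticToContinuum.FouriersLaw.Theorems.BondHeatUncertaintySubdiffusiveBondHeatIffBoundedResponse

/-!
# The spectral transfer: a Warburg cusp bound at the contact implies the Edwards–Wilkinson transient, hence (S)
# from the route's output

Crux `stmt-AtomisticToContinuum-9120` (`BondHeatUncertainty.SubdiffusiveBondHeat`, (S)), line `bath-bond-deficit-integral`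
(lead c5).  Notation VERBATIM the `let K / θ / E` of route `BoundaryEscapeDeficit`: `K_N(u) = ∫ (p₀² − T)·P_u(p₀² − T) dμ_T^N`,
`θ_N(s) = (γ/T²)∫₀ˢ K_N`, `E_N = 1 − (γ/T²)∫_{(0,∞)} K_N`; the WARBURG DIP `M_N(ω) = (γ/T²)∫_{(0,∞)} (1 − cos ωu) K_N(u) du`.

* `transientEW_of_contactWarburgModulus` — **`ContactWarburgModulus ⟹ TransientEW`** (crux-strategist s2's S⁺_G ⟹ (D1b),
  `STRATEGY-CENSUS.md` §Strengthen, derived there by hand; here kernel-checked): if for all parameters `> 0` and `T > 0` there are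
  `C, N₀` with `M_N(ω) ≤ C√|ω|` for `|ω| ≤ 1`, `N ≥ N₀` (the dip of the boundary noise spectrum below its DC value is no sharper
  than a `√|ω|` cusp — the Warburg law of a diffusive half-space terminated by a contact, as an UPPER bound), then the
  once-integrated transient obeys the Edwards–Wilkinson law `∫₀ᵗ (1 − θ_N(s) − E_N) ds ≤ C₂√t` for ALL `t ≥ 1` (in particular on
  every Thouless window `[1, cN²]`), `N ≥ max N₀ 2` — VERBATIM hypothesis 2 of `subdiffusiveBondHeat_of_ohmicFloor_transientEW`
  (p138777).  Proof: the transient is `(γ/T²)∫₀ᵗ∫_{(s,∞)}K_N` (`pinnedChain_transient_eq_tail`); the spectral identity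
  `c₁∫₀ᵗ∫_{(s,∞)}K_N = ∫_{(0,∞)}(1 − cos ωt)ω⁻² D_{K_N}(ω) dω` (`transientTail_eq_spectral`); the cusp bound on `(0,1]`; and the
  free ceiling `M_N(ω) ≤ 1` at every frequency (`warburgDip_le_one`, from the nonnegativity of the boundary noise spectrum,
  `cosTransform_kinCorr_nonneg`); explicit constant `C₂ = ((max C 0)·c₂ + 2)/c₁`;
  `transientEW_allTimes_of_contactWarburgModulus` — the window-free form (every `t ≥ 1`, no `t ≤ cN²`).
* `subdiffusiveBondHeat_of_boundedResponse_contactWarburgModulus` — with the landed circularity witness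
  (`subdiffusiveBondHeat_of_boundedResponse_transientEW`): **`BoundedResponse (11071) ∧ ContactWarburgModulus ⟹ (S)`**;
  `subdiffusiveBondHeat_of_escapeLaw_contactWarburgModulus` — the same from the sibling target `EscapeLaw` (12234);
  `subdiffusiveBondHeat_of_tail_crossover_contactWarburgModulus` — the same from the upper halves of `HalfChainTailLaw` (12235) and
  `DiffusiveCrossover` (12236) (landed bridge `stub_ohmicFloor_of_tail_crossover`).

Reading for the crux: the Ohm-free Edwards–Wilkinson factor of (S)|_{b=0} is implied by a single frequency-by-frequency
statement at the contact — a `√ω` modulus of continuity of the boundary noise spectrum at the infrared threshold, uniformly in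
`N`; its high-frequency half is free (landed here), its low-frequency half is the open content.  Nothing here closes the item.
-/

noncomputable section

open MeasureTheory Set Filter Topology intervalIntegral

namespace Summit.AtomisticToContinuum.FouriersLaw.Theorems.SubdiffusiveBondHeat

open Literature.MathematicalPhysics.KineticTheory.HeatConduction
open Summit.AtomisticToContinuum.FouriersLaw.Theses.BondHeatUncertainty (SubdiffusiveBondHeat BoundedResponse)
open Summit.AtomisticToContinuum.FouriersLaw.Theses.BoundaryEscapeDeficit (EscapeLaw HalfChainTailLaw DiffusiveCrossover)

/-! ### Fixed parameters, `N ≥ 2`: the Warburg cusp bound gives the EW transient at all times `t ≥ 1` -/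

section FixedN

variable {ω₂ lam β γ T : ℝ} (hω : 0 < ω₂) (hl : 0 < lam) (hβ : 0 < β) (hγ : 0 < γ) (hT : 0 < T) {N : ℕ}
  (hN : 2 ≤ N)
include hω hl hβ hγ hT hN

/-- **Warburg cusp ⟹ EW transient, fixed `N ≥ 2`**: if `(γ/T²)∫_{(0,∞)}(1 − cos ωu)K_N(u)du ≤ C√ω` for `0 < ω ≤ 1`, then for
every `t ≥ 1`, `∫₀ᵗ (γ/T²)∫_{(s,∞)} K_N ≤ ((max C 0)·c₂ + 2)/c₁ · √t` — the ceiling at `ω > 1` being free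
(`warburgDip_le_one`). [folklore] -/
theorem pinnedChain_transientIntegral_le_sqrt_of_warburg {C : ℝ}
    (hW : ∀ ω : ℝ, 0 < ω → ω ≤ 1 →
      γ / T ^ 2 * (∫ u in Ioi (0 : ℝ), (1 - Real.cos (ω * u)) *
        ∫ z, ((z.2 ⟨0, Nat.zero_lt_of_lt hN⟩) ^ 2 - T) *
            (∫ y, ((y.2 ⟨0, Nat.zero_lt_of_lt hN⟩) ^ 2 - T)
              ∂((pinnedChain ω₂ lam β γ).transitionKernel N T T u.toNNReal z))
          ∂((pinnedChain ω₂ lam β γ).gibbsMeasure N T)) ≤ C * Real.sqrt ω)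
    {t : ℝ} (ht : 1 ≤ t) :
    γ / T ^ 2 * ∫ s in (0 : ℝ)..t, (∫ u in Ioi s,
        ∫ z, ((z.2 ⟨0, Nat.zero_lt_of_lt hN⟩) ^ 2 - T) *
            (∫ y, ((y.2 ⟨0, Nat.zero_lt_of_lt hN⟩) ^ 2 - T)
              ∂((pinnedChain ω₂ lam β γ).transitionKernel N T T u.toNNReal z))
          ∂((pinnedChain ω₂ lam β γ).gibbsMeasure N T)) ≤
      ((max C 0) * (∫ v in Ioi (0 : ℝ), (1 - Real.cos v) / (v * Real.sqrt v)) + 2) /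
        (∫ ω in Ioi (0 : ℝ), (1 - Real.cos ω) / ω ^ 2) * Real.sqrt t := by
  have hN0 : 0 < N := Nat.zero_lt_of_lt hN
  obtain ⟨-, hKc, -, -, hKi⟩ := boundaryKernelBasics_proof ω₂ lam β γ hω hl hβ hγ T hT N hN0
  simp only [dif_pos hN0] at hKc hKi
  have hP : ∀ ω : ℝ, 0 < ω →
      γ / T ^ 2 * (∫ u in Ioi (0 : ℝ), (1 - Real.cos (ω * u)) *
        ∫ z, ((z.2 ⟨0, hN0⟩) ^ 2 - T) *
            (∫ y, ((y.2 ⟨0, hN0⟩) ^ 2 - T) ∂((pinnedChain ω₂ lam β γ).transitionKernel N T T u.toNNReal z))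
          ∂((pinnedChain ω₂ lam β γ).gibbsMeasure N T)) ≤ 1 := by
    intro ω _
    have h := warburgDip_le_one ω₂ lam β γ hω hl hβ hγ T hT N hN ω
    simpa only [dif_pos hN0] using h
  exact transientTail_le_sqrt_of_warburg hKc.measurable hKi hW hP ht

end FixedN

/-! ### The transfer, in the route's spelling -/

/-- **`ContactWarburgModulus ⟹ TransientEW`** (registered sub-goal; the conclusion is VERBATIM hypothesis 2 of
`subdiffusiveBondHeat_of_ohmicFloor_transientEW`, p138777, and holds for ALL `t ≥ 1`, the window constant being `c = 1`):
a `√|ω|` Warburg cusp bound on the dip of the boundary noise spectrum, uniformly in `N ≥ N₀`, implies the Edwards–Wilkinson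
law of the once-integrated bath-heat transient with `C₂ = ((max C 0)·c₂ + 2)/c₁`, `N ≥ max N₀ 2`. [folklore] -/
theorem transientEW_of_contactWarburgModulus :
    (∀ ω₂ lam β γ : ℝ, 0 < ω₂ → 0 < lam → 0 < β → 0 < γ → ∀ T : ℝ, 0 < T → ∃ C : ℝ, ∃ N₀ : ℕ, ∀ N : ℕ, N₀ ≤ N → ∀ ω : ℝ, |ω| ≤ 1 → γ / T ^ 2 * (∫ u in Set.Ioi (0 : ℝ), (1 - Real.cos (ω * u)) * (if h : 0 < N then ∫ z, ((z.2 ⟨0, h⟩) ^ 2 - T) * (∫ y, ((y.2 ⟨0, h⟩) ^ 2 - T) ∂((Literature.MathematicalPhysics.KineticTheory.HeatConduction.pinnedChain ω₂ lam β γ).transitionKernel N T T u.toNNReal z)) ∂((Literature.MathematicalPhysics.KineticTheory.HeatConduction.pinnedChain ω₂ lam β γ).gibbsMeasure N T) else 0)) ≤ C * Real.sqrt |ω|) → (∀ ω₂ lam β γ : ℝ, 0 < ω₂ → 0 < lam → 0 < β → 0 < γ → ∀ T : ℝ, 0 < T → ∃ C₂ c : ℝ, 0 < c ∧ ∃ N₀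 : ℕ, ∀ N : ℕ, N₀ ≤ N → ∀ t : ℝ, 1 ≤ t → t ≤ c * (N : ℝ) ^ 2 → (∫ s in (0 : ℝ)..t, (1 - γ / T ^ 2 * (∫ u in (0 : ℝ)..s, if h : 0 < N then ∫ z, ((z.2 ⟨0, h⟩) ^ 2 - T) * (∫ y, ((y.2 ⟨0, h⟩) ^ 2 - T) ∂((Literature.MathematicalPhysics.KineticTheory.HeatConduction.pinnedChain ω₂ lam β γ).transitionKernel N T T u.toNNReal z)) ∂((Literature.MathematicalPhysics.KineticTheory.HeatConduction.pinnedChain ω₂ lam β γ).gibbsMeasure N T) else 0) - (1 - γ / T ^ 2 * (∫ u in Set.Ioi (0 : ℝ), if h : 0 < N then ∫ z, ((z.2 ⟨0, h⟩) ^ 2 - T) * (∫ y, ((y.2 ⟨0, h⟩) ^ 2 - T) ∂((Literature.MathematicalPhysics.KineticTheory.HeatConduction.pinnedChain ω₂ lam β γ).transitionKernel N T T u.toNNReal z)) ∂((Literature.MathematicalPhysics.KineticTheory.HeatConduction.pinnedChain ω₂ lam β γ).gibbsMeasure N T) else 0)))) ≤ C₂ * Real.sqrt t) := by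
  intro hW ω₂ lam β γ hω hl hβ hγ T hT
  obtain ⟨C, N₀, hC⟩ := hW ω₂ lam β γ hω hl hβ hγ T hT
  refine ⟨((max C 0) * (∫ v in Ioi (0 : ℝ), (1 - Real.cos v) / (v * Real.sqrt v)) + 2) /
      (∫ ω in Ioi (0 : ℝ), (1 - Real.cos ω) / ω ^ 2), 1, one_pos, max N₀ 2, fun N hN t ht _ => ?_⟩
  have hN2 : 2 ≤ N := le_trans (le_max_right _ _) hN
  have hNN₀ : N₀ ≤ N := le_trans (le_max_left _ _) hN
  have hN0 : 0 < N := Nat.zero_lt_of_lt hN2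
  have ht0 : 0 ≤ t := zero_le_one.trans ht
  -- the integrand is the tail `(γ/T²)∫_{(s,∞)} K_N` on `[0, t]`
  have htail := pinnedChain_transient_eq_tail ω₂ lam β γ hω hl hβ hγ T hT N hN0
  rw [intervalIntegral.integral_congr (g := fun s => γ / T ^ 2 * ∫ u in Set.Ioi s,
      ∫ z, ((z.2 ⟨0, hN0⟩) ^ 2 - T) *
        (∫ y, ((y.2 ⟨0, hN0⟩) ^ 2 - T) ∂((pinnedChain ω₂ lam β γ).transitionKernel N T T u.toNNReal z))
      ∂((pinnedChain ω₂ lam β γ).gibbsMeasure N T)) (fun s hs => by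
        rw [uIcc_of_le ht0] at hs
        exact htail s hs.1),
    intervalIntegral.integral_const_mul]
  -- the Warburg hypothesis at this `N`, for `0 < ω ≤ 1`
  have hW' : ∀ ω : ℝ, 0 < ω → ω ≤ 1 →
      γ / T ^ 2 * (∫ u in Ioi (0 : ℝ), (1 - Real.cos (ω * u)) *
        ∫ z, ((z.2 ⟨0, Nat.zero_lt_of_lt hN2⟩) ^ 2 - T) *
            (∫ y, ((y.2 ⟨0, Nat.zero_lt_of_lt hN2⟩) ^ 2 - T)
              ∂((pinnedChain ω₂ lam β γ).transitionKernel N T T u.toNNReal z))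
          ∂((pinnedChain ω₂ lam β γ).gibbsMeasure N T)) ≤ C * Real.sqrt ω := by
    intro ω hω0 hω1
    have habs : |ω| ≤ 1 := by rw [abs_of_pos hω0]; exact hω1
    have h := hC N hNN₀ ω habs
    rw [abs_of_pos hω0] at h
    simpa only [dif_pos hN0] using h
  exact pinnedChain_transientIntegral_le_sqrt_of_warburg hω hl hβ hγ hT hN2 hW' ht

/-- **Window-free form**: under `ContactWarburgModulus` the EW transient bound holds for EVERY `t ≥ 1` (no Thouless window), `N ≥ max N₀ 2`,
with the same constant — the hypothesis is frequency-local and `N`-uniform, so nothing ties `t` to `N`. [folklore] -/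
theorem transientEW_allTimes_of_contactWarburgModulus
    (hW : ∀ ω₂ lam β γ : ℝ, 0 < ω₂ → 0 < lam → 0 < β → 0 < γ → ∀ T : ℝ, 0 < T →
      ∃ C : ℝ, ∃ N₀ : ℕ, ∀ N : ℕ, N₀ ≤ N → ∀ ω : ℝ, |ω| ≤ 1 →
        γ / T ^ 2 * (∫ u in Set.Ioi (0 : ℝ), (1 - Real.cos (ω * u)) *
          (if h : 0 < N then
            ∫ z, ((z.2 ⟨0, h⟩) ^ 2 - T) *
                (∫ y, ((y.2 ⟨0, h⟩) ^ 2 - T) ∂((pinnedChain ω₂ lam β γ).transitionKernel N T T u.toNNReal z))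
              ∂((pinnedChain ω₂ lam β γ).gibbsMeasure N T)
          else 0)) ≤ C * Real.sqrt |ω|) :
    ∀ ω₂ lam β γ : ℝ, 0 < ω₂ → 0 < lam → 0 < β → 0 < γ → ∀ T : ℝ, 0 < T →
      ∃ C₂ : ℝ, ∃ N₀ : ℕ, ∀ N : ℕ, N₀ ≤ N → ∀ t : ℝ, 1 ≤ t →
        (∫ s in (0 : ℝ)..t,
          (1 - γ / T ^ 2 * (∫ u in (0 : ℝ)..s,
              if h : 0 < N then
                ∫ z, ((z.2 ⟨0, h⟩) ^ 2 - T) *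
                    (∫ y, ((y.2 ⟨0, h⟩) ^ 2 - T)
                      ∂((pinnedChain ω₂ lam β γ).transitionKernel N T T u.toNNReal z))
                  ∂((pinnedChain ω₂ lam β γ).gibbsMeasure N T)
              else 0) -
            (1 - γ / T ^ 2 * (∫ u in Set.Ioi (0 : ℝ),
              if h : 0 < N then
                ∫ z, ((z.2 ⟨0, h⟩) ^ 2 - T) *
                    (∫ y, ((y.2 ⟨0, h⟩) ^ 2 - T)
                      ∂((pinnedChain ω₂ lam β γ).transitionKernel N T T u.toNNReal z))
                  ∂((pinnedChain ω₂ lam β γ).gibbsMeasure N T)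
              else 0)))) ≤ C₂ * Real.sqrt t := by
  intro ω₂ lam β γ hω hl hβ hγ T hT
  obtain ⟨C, N₁, hC⟩ := hW ω₂ lam β γ hω hl hβ hγ T hT
  refine ⟨((max C 0) * (∫ v in Ioi (0 : ℝ), (1 - Real.cos v) / (v * Real.sqrt v)) + 2) /
      (∫ ω in Ioi (0 : ℝ), (1 - Real.cos ω) / ω ^ 2), max N₁ 2, fun N hN t ht => ?_⟩
  have hN2 : 2 ≤ N := le_trans (le_max_right _ _) hN
  have hNN₁ : N₁ ≤ N := le_trans (le_max_left _ _) hN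
  have hN0 : 0 < N := Nat.zero_lt_of_lt hN2
  have ht0 : 0 ≤ t := zero_le_one.trans ht
  have htail := pinnedChain_transient_eq_tail ω₂ lam β γ hω hl hβ hγ T hT N hN0
  rw [intervalIntegral.integral_congr (g := fun s => γ / T ^ 2 * ∫ u in Set.Ioi s,
      ∫ z, ((z.2 ⟨0, hN0⟩) ^ 2 - T) *
        (∫ y, ((y.2 ⟨0, hN0⟩) ^ 2 - T) ∂((pinnedChain ω₂ lam β γ).transitionKernel N T T u.toNNReal z))
      ∂((pinnedChain ω₂ lam β γ).gibbsMeasure N T)) (fun s hs => by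
        rw [uIcc_of_le ht0] at hs
        exact htail s hs.1),
    intervalIntegral.integral_const_mul]
  have hW' : ∀ ω : ℝ, 0 < ω → ω ≤ 1 →
      γ / T ^ 2 * (∫ u in Ioi (0 : ℝ), (1 - Real.cos (ω * u)) *
        ∫ z, ((z.2 ⟨0, Nat.zero_lt_of_lt hN2⟩) ^ 2 - T) *
            (∫ y, ((y.2 ⟨0, Nat.zero_lt_of_lt hN2⟩) ^ 2 - T)
              ∂((pinnedChain ω₂ lam β γ).transitionKernel N T T u.toNNReal z))
          ∂((pinnedChain ω₂ lam β γ).gibbsMeasure N T)) ≤ C * Real.sqrt ω := by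
    intro ω hω0 hω1
    have habs : |ω| ≤ 1 := by rw [abs_of_pos hω0]; exact hω1
    have h' := hC N hNN₁ ω habs
    rw [abs_of_pos hω0] at h'
    simpa only [dif_pos hN0] using h'
  exact pinnedChain_transientIntegral_le_sqrt_of_warburg hω hl hβ hγ hT hN2 hW' ht

/-- **`BoundedResponse ∧ ContactWarburgModulus ⟹ (S)`**: the route's output (stmt-AtomisticToContinuum-11071) and a `√|ω|`
Warburg cusp bound on the boundary noise spectrum give the crux — the landed circularity witness
`subdiffusiveBondHeat_of_boundedResponse_transientEW` fed with `transientEW_of_contactWarburgModulus`. [folklore] -/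
theorem subdiffusiveBondHeat_of_boundedResponse_contactWarburgModulus : BoundedResponse →
    (∀ ω₂ lam β γ : ℝ, 0 < ω₂ → 0 < lam → 0 < β → 0 < γ → ∀ T : ℝ, 0 < T →
      ∃ C : ℝ, ∃ N₀ : ℕ, ∀ N : ℕ, N₀ ≤ N → ∀ ω : ℝ, |ω| ≤ 1 →
        γ / T ^ 2 * (∫ u in Set.Ioi (0 : ℝ), (1 - Real.cos (ω * u)) *
          (if h : 0 < N then
            ∫ z, ((z.2 ⟨0, h⟩) ^ 2 - T) *
                (∫ y, ((y.2 ⟨0, h⟩) ^ 2 - T) ∂((pinnedChain ω₂ lam β γ).transitionKernel N T T u.toNNReal z))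
              ∂((pinnedChain ω₂ lam β γ).gibbsMeasure N T)
          else 0)) ≤ C * Real.sqrt |ω|) →
    SubdiffusiveBondHeat := fun hB hW =>
  subdiffusiveBondHeat_of_boundedResponse_transientEW hB (transientEW_of_contactWarburgModulus hW)

/-- **`EscapeLaw ∧ ContactWarburgModulus ⟹ (S)`**: the same from the sibling route's target `BoundaryEscapeDeficit.EscapeLaw`
(stmt-AtomisticToContinuum-12234), via `subdiffusiveBondHeat_of_escapeLaw_transientEW` (p138777). [folklore] -/
theorem subdiffusiveBondHeat_of_escapeLaw_contactWarburgModulus : EscapeLaw →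
    (∀ ω₂ lam β γ : ℝ, 0 < ω₂ → 0 < lam → 0 < β → 0 < γ → ∀ T : ℝ, 0 < T →
      ∃ C : ℝ, ∃ N₀ : ℕ, ∀ N : ℕ, N₀ ≤ N → ∀ ω : ℝ, |ω| ≤ 1 →
        γ / T ^ 2 * (∫ u in Set.Ioi (0 : ℝ), (1 - Real.cos (ω * u)) *
          (if h : 0 < N then
            ∫ z, ((z.2 ⟨0, h⟩) ^ 2 - T) *
                (∫ y, ((y.2 ⟨0, h⟩) ^ 2 - T) ∂((pinnedChain ω₂ lam β γ).transitionKernel N T T u.toNNReal z))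
              ∂((pinnedChain ω₂ lam β γ).gibbsMeasure N T)
          else 0)) ≤ C * Real.sqrt |ω|) →
    SubdiffusiveBondHeat := fun hE hW =>
  subdiffusiveBondHeat_of_escapeLaw_transientEW hE (transientEW_of_contactWarburgModulus hW)

/-- **`HalfChainTailLaw ∧ DiffusiveCrossover ∧ ContactWarburgModulus ⟹ (S)`**: the Ohmic floor from the UPPER halves of the sibling
route's two cruxes (stmt-AtomisticToContinuum-12235, 12236; landed bridge `stub_ohmicFloor_of_tail_crossover`) and the EW transient from
the Warburg cusp bound — `subdiffusiveBondHeat_of_ohmicFloor_transientEW` (p138777). [folklore] -/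
theorem subdiffusiveBondHeat_of_tail_crossover_contactWarburgModulus : HalfChainTailLaw → DiffusiveCrossover →
    (∀ ω₂ lam β γ : ℝ, 0 < ω₂ → 0 < lam → 0 < β → 0 < γ → ∀ T : ℝ, 0 < T →
      ∃ C : ℝ, ∃ N₀ : ℕ, ∀ N : ℕ, N₀ ≤ N → ∀ ω : ℝ, |ω| ≤ 1 →
        γ / T ^ 2 * (∫ u in Set.Ioi (0 : ℝ), (1 - Real.cos (ω * u)) *
          (if h : 0 < N then
            ∫ z, ((z.2 ⟨0, h⟩) ^ 2 - T) *
                (∫ y, ((y.2 ⟨0, h⟩) ^ 2 - T) ∂((pinnedChain ω₂ lam β γ).transitionKernel N T T u.toNNReal z))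
              ∂((pinnedChain ω₂ lam β γ).gibbsMeasure N T)
          else 0)) ≤ C * Real.sqrt |ω|) →
    SubdiffusiveBondHeat := fun hT hX hW =>
  subdiffusiveBondHeat_of_ohmicFloor_transientEW (stub_ohmicFloor_of_tail_crossover hT hX)
    (transientEW_of_contactWarburgModulus hW)

end Summit.AtomisticToContinuum.FouriersLaw.Theorems.SubdiffusiveBondHeat

end
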